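import Literature.Probability.FitznerVanDerHofstad2017.Stage1Cells
import Literature.Probability.FitznerVanDerHofstad2017.NoGoFrame

/-!
# Literature.Probability.FitznerVanDerHofstad2017.Stage1Frame — the typed stage 1 as a `NoGoFrame.Frame` whose
monotonicity hypotheses are theorems

CITATION HEADER (PLACEMENT v2). Part of the certified REPRODUCTION of R. Fitzner, R. van der Hofstad, *Mean-field
behavior for nearest-neighbor percolation in d > 10*, EJP 22 (2017) no. 43 [FvdH17] (notebook `Percolation.nb`) and
*Generalized approach to the non-backtracking lace expansion*, PTRF 169 (2017) 1041–1119 [NoBLE17]; build `lace`, seat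
lean1 (gen 4), node N28 / GAPS G19 (1) / REFEREE R38.3.

What this module is.  It gives the cells of `Stage1Cells.lean` their real SEMANTICS at a state `y = (Γ₁, m, Γ₂, c)` of
`NoGoFrame` and at the two points `s ∈ {i, o}` (cell 3: `z[i] = 1/(2d−1)`, `z[o] = Γ₁/(2d−1)`, `VarGamma2[i] =
(2d−2)/(2d−1)`, `VarGamma2[o] = Γ₂ (2d−2)/(2d−1)`; cells 13–14: the weights `c_j·Γ₃`, `Γ₃ = 1`, at `o` and the initial
cells `BoundFThreeInital[…]` at `i`; cell 10: `mubOverMu[s] = 1/(1 − Bound[G,{1},3,s])`; cell 39), assembles the four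
LOWER bounds of cells 36–37/44 with their decreasing brackets and the sixty-field App. D input record of cell 44
(`BetaMap.Inputs`, tail-free variant `T″₀`: `EvenTail := Bound[·,2,·]`, `OddTail := Bound[·,3,·]`), and packages
everything with the static data (integer parameters, SRW tables, switches, lattice points) as a `NoGoFrame.Frame`
— `Stage1Cells.Data.frame`.  Its validity region `U` is: at both points the two geometric ratios `Bound[G,{1},3,s]`,
`Bound[OpenBubble,1,s]` are `< 1` (the series behind `mubOverMu` and `Hdash` converge) and the five maximal bracket
arguments of the product lower bounds of cells 36–37 are `≤ 1` (each factor `1 − (…)` of `Bound[Pi,1,Lower,s]`,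
`Bound[Psi,alphaI/II,0−1,…]` is the lower bound on a probability that the derivation multiplies, valid as a product
only while the factors are `≥ 0`).  MAIN THEOREMS (the stage-1 monotonicity inputs of the no-go theorem, REFEREE R38.3,
formerly the sign census HOME/MARGINS.md M1–M6): above any floor `y₀` with `Γ₁(y₀), Γ₂(y₀) ≥ 1`, `c(y₀) ≥ 0`, for
`d ≥ 2` and non-negative tables (`Data.Std`), `U` is downward closed (`Data.Std.U_down`), stage 1 is fieldwise monotone
in the mixed-sign order `BetaMap.Inputs.Dom` between comparable states whose upper one lies in `U` (`Data.Std.mono`),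
has the structural signs `Stage1.Nonneg` on `U` (`Data.Std.nonneg`), and `mu[s] = m` (`Data.mu_eq`); `Data.Std.hyp`
assembles `NoGoFrame.Frame.Hyp y₀` from these, leaving only the floor sign checks `0 ≤ m(y₀)`, `0 ≤ 1 + β_Π̂(y₀,s)`.
Nothing here is a cited fact.

SCOPE NOTE (the bracket conditions of `U`).  `NoGoFrame.Frame.Closes y` contains `y ∈ U`; with this frame that reads:
the two geometric ratios `< 1` AND the five bracket arguments `≤ 1` at both points.  The product lower bounds of cells
36–37 are antitone only there (a product of two sign-changing decreasing factors is not monotone), and only there are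
they the bounds the derivation claims; at the published `d = 11` tuple the seven quantities are `≤ 0.081`
(`Bound[OpenBubble,1,o]`; the brackets are `≤ 0.066`, `Bound[G,{1},3,o] = 0.0030`), so the restriction is far from the
computation it speaks about (HOME/lean1 validation log, gen 4).

VALIDATION.  The typed stage 1 (this file's real assembly mirrored over `Float`, the cells by `PX.evalF`) was
re-evaluated at `d = 11` for `(ComputedSteps, MaxNumberOfSteps) = (10,20), (12,28), (9,20)` at the published tuple and
compared with engine A (HOME/num1/engineA, float back-end, tables as printed): all sixty App. D inputs at both points,
the three `G`'s and 238 intermediate quantities (matrices, vectors, diagrams, `N`-terms) agree to relative `1.5e-14`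
(HOME/lean1 validation log, gen 4; scripts under the seat folder `work/validate/`).

[cite: FitznerVanDerHofstad2017, notebook Percolation.nb cells 3–44 (transcript l.169–1237)]
-/

noncomputable section

namespace Literature.Probability.FitznerVanDerHofstad2017
namespace Stage1Cells

open NoGoFrame F3Bounds BetaMap PX

/-! ## Tables -/

/-- The stage-1 SRW data over the lattice-point classes `V`: the integrals `Ivalue[n,l,v]`, `K[n,l,v]` of `SRW.nb`
(`K` is the same table as `F3Bounds.Tables.K`, there indexed by the frame's abstract points; supplying the two
consistently is the instantiating certificate's business) and the walk counts `nrSAW[j,d,v]`, `nrBAW[j,d,v]` at the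
frame's dimension. [cite: FitznerVanDerHofstad2017, notebook Percolation.nb cells 5–24; notebook SRW.nb] -/
structure Tabs where
  /-- `Ivalue[n,l,v]` -/
  I : ℕ → ℕ → V → ℝ
  /-- `K[n,l,v]` -/
  K : ℕ → ℕ → V → ℝ
  /-- `nrSAW[j,d,v]` -/
  saw : ℕ → V → ℝ
  /-- `nrBAW[j,d,v]` -/
  baw : ℕ → V → ℝ

/-- Well-formed tables at dimension `d`: all entries `≥ 0` and the three walk-count differences of cells 7–8 are `≥ 0`
(`nrSAW[6,d,e₁+e₂] ≥ 36(d−2)²`, `nrSAW[4,d,e₁+e₂] ≥ 2(d−2)`, `nrSAW[6,d,2e₁] ≥ 36(d−2)²`: the subtracted counts are those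
of the 6- and 4-step SAWs through the excluded point, [FvdH17] §4.1). [folklore] -/
structure Tabs.WF (t : Tabs) (d : ℕ) : Prop where
  I : ∀ n l v, 0 ≤ t.I n l v
  K : ∀ n l v, 0 ≤ t.K n l v
  saw : ∀ j v, 0 ≤ t.saw j v
  baw : ∀ j v, 0 ≤ t.baw j v
  sawIk6 : 36 * ((d : ℝ) - 2) ^ 2 ≤ t.saw 6 .v2
  sawIk4 : 2 * ((d : ℝ) - 2) ≤ t.saw 4 .v2
  sawTwoi6 : 36 * ((d : ℝ) - 2) ^ 2 ≤ t.saw 6 .v01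

/-- The table valuation of `Stage1Cells.TKey`. [folklore] -/
def Tabs.val (t : Tabs) (d : ℕ) : TKey → ℝ
  | .I n l v => t.I n l v
  | .K n l v => t.K n l v
  | .saw j v => t.saw j v
  | .baw j v => t.baw j v
  | .sawIk6 => t.saw 6 .v2 - 36 * ((d : ℝ) - 2) ^ 2
  | .sawIk4 => t.saw 4 .v2 - 2 * ((d : ℝ) - 2)
  | .sawTwoi6 => t.saw 6 .v01 - 36 * ((d : ℝ) - 2) ^ 2

/-- Well-formed tables value every key `≥ 0`. [folklore] -/
theorem Tabs.WF.val_nonneg {t : Tabs} {d : ℕ} (h : t.WF d) : ∀ k, 0 ≤ t.val d k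
  | .I n l v => h.I n l v
  | .K n l v => h.K n l v
  | .saw j v => h.saw j v
  | .baw j v => h.baw j v
  | .sawIk6 => sub_nonneg.2 h.sawIk6
  | .sawIk4 => sub_nonneg.2 h.sawIk4
  | .sawTwoi6 => sub_nonneg.2 h.sawTwoi6

/-! ## The data of a typed frame and the two valuations -/

/-- The STATIC DATA of the typed d-dimensional computation: the integer parameters of cell 2, the stage-1 tables, and
the data of `NoGoFrame.Frame` for cells 48–54 (the `f₃` tables over abstract points `ν`, the switch `ValueQ[T[2,0,{3}]]`,
the four variant switches, the seven named points). [cite: FitznerVanDerHofstad2017, notebook Percolation.nb cells 2, 48–54] -/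
structure Data (ν : Type*) where
  /-- `d`, `ComputedSteps`, `MaxNumberOfSteps` -/
  P : Params
  /-- stage-1 tables -/
  tabs : Tabs
  /-- `f₃` tables (cells 48–54) -/
  τ : Tables ν
  /-- `ValueQ[T[2,0,{3}]]` -/
  hasT203 : Bool
  /-- D20 switch of `NoGoFrame.Frame` -/
  codedD20 : Bool
  /-- D31 switch -/
  codedD31 : Bool
  /-- D33 switch -/
  codedD33 : Bool
  /-- D36(b) switch -/
  printedD36 : Bool
  /-- `{0}` -/
  n0 : ν
  /-- `{1}` -/
  n1 : ν
  /-- `{2}` -/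
  n2 : ν
  /-- `{3}` -/
  n3 : ν
  /-- `{0,1}` -/
  n01 : ν
  /-- `{1,1}` -/
  n11 : ν
  /-- `{0,0,1}` -/
  n001 : ν

namespace Data

variable {ν : Type*} (D : Data ν)

/-- the dimension as a real. [folklore] -/
def dR : ℝ := (D.P.d : ℝ)

/-- One initial-point cell in the variant selected by `printedD36` (= `NoGoFrame.Frame.initAt` of `D.frame`). [cite: FitznerVanDerHofstad2017, notebook Percolation.nb cell 48 (transcript l.1328–1333)] -/
def initAt (n l : ℕ) (v₀ : ν) (vs : List ν) : ℝ :=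
  if D.printedD36 then boundFThreeInitialPrinted D.τ D.dR n l 1 v₀ vs else boundFThreeInitial D.τ D.dR n l 1 v₀ vs

/-- The six initial-point cells `boundF3[j,i]` (= `Frame.initCell` of `D.frame`, `Data.frame_initCell`); they are the
weighted constants of cell 13 at the point `i`. [cite: FitznerVanDerHofstad2017, notebook Percolation.nb cells 13, 48] -/
def initCell : Fin 6 → ℝ :=
  ![ D.initAt 1 6 D.n0 [],
     D.initAt 0 0 D.n1 [D.n2, D.n01],
     D.initAt 1 0 D.n1 [D.n2, D.n01],
     D.initAt 1 1 D.n1 [D.n2, D.n01],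
     D.initAt 1 2 D.n1 [D.n2, D.n01],
     D.initAt 1 3 D.n1 [D.n2, D.n01] ]

/-- `z[s]` (cell 3): `z[i] = 1/(2d−1)`, `z[o] = Γ₁/(2d−1)`. [cite: FitznerVanDerHofstad2017, notebook Percolation.nb cell 3 (transcript l.171–175)] -/
def zAt : Pt → State → ℝ
  | .i, _ => 1 / (2 * D.dR - 1)
  | .o, y => y.Gamma1 / (2 * D.dR - 1)

/-- `VarGamma2[s]` (cell 3): `(2d−2)/(2d−1)` at `i`, `Γ₂ (2d−2)/(2d−1)` at `o`. [cite: FitznerVanDerHofstad2017, notebook Percolation.nb cell 3 (transcript l.171–175)] -/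
def VAt : Pt → State → ℝ
  | .i, _ => (2 * D.dR - 2) / (2 * D.dR - 1)
  | .o, y => y.Gamma2 * ((2 * D.dR - 2) / (2 * D.dR - 1))

/-- the weighted constants (cells 13–14): `boundF3[j,i]` at `i`, `c_j Γ₃ = c_j` at `o`. [cite: FitznerVanDerHofstad2017, notebook Percolation.nb cells 13–14 (transcript l.400–470)] -/
def cAt : Pt → State → Fin 6 → ℝ
  | .i, _ => D.initCell
  | .o, y => y.c

/-- The BASIC valuation at point `s` and state `y` (derived atoms valued `0`). [folklore] -/
def val0 (s : Pt) (y : State) : Atom → ℝ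
  | .z => D.zAt s y
  | .V => D.VAt s y
  | .cw j => D.cAt s y j
  | .Vo => D.VAt .o y
  | .G13at _ => 0
  | .mubOverMu => 0
  | .mubOverMuI => 0
  | .hdInv => 0

/-- evaluation of a term under the basic valuation. [folklore] -/
def ev0 (s : Pt) (y : State) (e : T) : ℝ := e.eval (D.val0 s y) (D.tabs.val D.P.d)

/-- `Bound[G,{1},3,s]` (cell 5). [cite: FitznerVanDerHofstad2017, notebook Percolation.nb cell 5] -/
def g13 (s : Pt) (y : State) : ℝ := D.ev0 s y (G13 D.P)

/-- `Bound[OpenBubble,1,s]` (cell 12). [cite: FitznerVanDerHofstad2017, notebook Percolation.nb cell 12] -/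
def ob1 (s : Pt) (y : State) : ℝ := D.ev0 s y (openBubble D.P 1 0)

/-- The FULL valuation: the basic one extended by `Bound[G,{1},3,t]`, `mubOverMu[s] = 1/(1 − Bound[G,{1},3,s])` (cell 10),
`mubOverMu[i]`, and `1/(1 − Bound[OpenBubble,1,s])` (cell 39). [cite: FitznerVanDerHofstad2017, notebook Percolation.nb cells 10, 39] -/
def val (s : Pt) (y : State) : Atom → ℝ
  | .G13at t => D.g13 t y
  | .mubOverMu => 1 / (1 - D.g13 s y)
  | .mubOverMuI => 1 / (1 - D.g13 .i y)
  | .hdInv => 1 / (1 - D.ob1 s y)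
  | a => D.val0 s y a

/-- evaluation of a cell at point `s` and state `y`. [folklore] -/
def ev (s : Pt) (y : State) (e : T) : ℝ := e.eval (D.val s y) (D.tabs.val D.P.d)

/-! ## The validity region -/

/-- The stage-1 validity conditions AT ONE POINT: the two geometric ratios `< 1` and the five maximal bracket arguments
of the product lower bounds of cells 36–37 `≤ 1` (they dominate the other four: `Data.brackets_le_one`). [folklore] -/
structure UAt (s : Pt) (y : State) : Prop where
  g13 : D.g13 s y < 1
  ob1 : D.ob1 s y < 1
  br3a : D.ev s y (pi1Br3a D.P) ≤ 1
  br5a : D.ev s y (pi1Br5a D.P) ≤ 1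
  br5b : D.ev s y (pi1Br5b D.P) ≤ 1
  brIIA : D.ev s y (PsiAlphaII01brA D.P) ≤ 1
  brIIB : D.ev s y (PsiAlphaII01brB D.P) ≤ 1

/-- The stage-1 VALIDITY REGION `U` of the typed frame: `UAt` at both points. [folklore] -/
def U (y : State) : Prop := ∀ s, D.UAt s y

/-! ## Cells 36–37, 44: the lower bounds and the two bracketed upper bounds -/

/-- `z[i] = 1/(2d−1)` as a real. [folklore] -/
def zIr : ℝ := 1 / (2 * D.dR - 1)

/-- cell 36: the constant `(2d−1)(2d−2) z_i⁴ (1−z_i³)^{2d−3}` of `Bound[Pi,alpha,lower,0,s]` and `Bound[Psi,lower,0,s]`.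
[cite: FitznerVanDerHofstad2017, notebook Percolation.nb cell 36] -/
def K1 : ℝ := (2 * D.dR - 1) * (2 * D.dR - 2) * D.zIr ^ 4 * (1 - D.zIr ^ 3) ^ (2 * D.P.d - 3)
/-- cell 36: `16(d−1)(d−2)(2d−3) z_i⁶ (1−z_i³)^{2d−2} (1−z_i⁵)^{16(d−1)(d−2)−1}`.
[cite: FitznerVanDerHofstad2017, notebook Percolation.nb cell 36] -/
def K2 : ℝ := 16 * (D.dR - 1) * (D.dR - 2) * (2 * D.dR - 3) * D.zIr ^ 6 * (1 - D.zIr ^ 3) ^ (2 * D.P.d - 2)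
  * (1 - D.zIr ^ 5) ^ (16 * (D.P.d - 1) * (D.P.d - 2) - 1)
/-- cell 36: `4·16 d(d−1)(d−2) z_i⁶ (1−z_i)(1−z_i³)^{2d−2}(1−z_i⁵)^{16(d−1)(d−2)}`.
[cite: FitznerVanDerHofstad2017, notebook Percolation.nb cell 36] -/
def K3 : ℝ := 4 * 16 * D.dR * (D.dR - 1) * (D.dR - 2) * D.zIr ^ 6 * (1 - D.zIr) * (1 - D.zIr ^ 3) ^ (2 * D.P.d - 2)
  * (1 - D.zIr ^ 5) ^ (16 * (D.P.d - 1) * (D.P.d - 2))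
/-- cell 36: `(2d−2)²(2d−3) z_i⁷ (1−z_i³)^{2d−3}`.
[cite: FitznerVanDerHofstad2017, notebook Percolation.nb cell 36] -/
def K4 : ℝ := (2 * D.dR - 2) ^ 2 * (2 * D.dR - 3) * D.zIr ^ 7 * (1 - D.zIr ^ 3) ^ (2 * D.P.d - 3)
/-- cell 36: `(2d−2)³(2d−3) z_i⁸ (1−z_i³)^{2d−3}`.
[cite: FitznerVanDerHofstad2017, notebook Percolation.nb cell 36] -/
def K5 : ℝ := (2 * D.dR - 2) ^ 3 * (2 * D.dR - 3) * D.zIr ^ 8 * (1 - D.zIr ^ 3) ^ (2 * D.P.d - 3)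

/-- Cell 36: `Bound[Pi,alpha,lower,0,s] = K₁ − piAlphaLowSub[s] + K₂ (1 − piAlphaLowBr[s])`. [cite: FitznerVanDerHofstad2017, notebook Percolation.nb cell 36 (transcript l.1013–1026)] -/
def piAlphaLower0 (s : Pt) (y : State) : ℝ :=
  D.K1 - D.ev s y (piAlphaLowSub D.P) + D.K2 * (1 - D.ev s y (piAlphaLowBr D.P))

/-- Cell 36: `Bound[Psi,lower,0,s] = K₁ − piAlphaLowSub[s] + (2d−2)² z_i⁴ (1 − psiLowBr1[s]) − 2d(2d−2) z_i⁴ ϑ[s]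
+ K₃ (1 − psiLowBr2[s])`. [cite: FitznerVanDerHofstad2017, notebook Percolation.nb cell 36 (transcript l.1013–1026)] -/
def psiLower0 (s : Pt) (y : State) : ℝ :=
  D.K1 - D.ev s y (piAlphaLowSub D.P) + (2 * D.dR - 2) ^ 2 * D.zIr ^ 4 * (1 - D.ev s y (psiLowBr1 D.P))
    - 2 * D.dR * (2 * D.dR - 2) * D.zIr ^ 4 * D.ev s y (vartheta D.P) + D.K3 * (1 - D.ev s y (psiLowBr2 D.P))

/-- Cell 36: `Bound[Pi,1,Lower,s] = (2d−1)(2d−2) z_i⁵ (1 − Br₀) − (2d−2) z_i⁵ (θ₄ + ϑ) + K₄ (1 − Br₃a)(1 − Br₃b)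
+ K₄ (1 − Br₄a)(1 − Br₄b) + K₅ (1 − Br₅a)(1 − Br₅b)`. [cite: FitznerVanDerHofstad2017, notebook Percolation.nb cell 36 (transcript l.1013–1026)] -/
def pi1Lower (s : Pt) (y : State) : ℝ :=
  (2 * D.dR - 1) * (2 * D.dR - 2) * D.zIr ^ 5 * (1 - D.ev s y (pi1Br0 D.P))
    - (2 * D.dR - 2) * D.zIr ^ 5 * D.ev s y (pi1T2 D.P)
    + D.K4 * ((1 - D.ev s y (pi1Br3a D.P)) * (1 - D.ev s y (pi1Br3b D.P)))
    + D.K4 * ((1 - D.ev s y (pi1Br4a D.P)) * (1 - D.ev s y (pi1Br4b D.P)))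
    + D.K5 * ((1 - D.ev s y (pi1Br5a D.P)) * (1 - D.ev s y (pi1Br5b D.P)))

/-- Cell 37: `Bound[Psi,alphaI,0−1,AroundEi,s] = main[s] + coef · (1 − 2 (1 − brA[s])(1 − brB[s]))`. [cite: FitznerVanDerHofstad2017, notebook Percolation.nb cell 37 (transcript l.1035–1055)] -/
def psiAlphaI01 (s : Pt) (y : State) : ℝ :=
  D.ev s y (PsiAlphaI01main D.P)
    + D.ev s y (PsiAlphaI01coef D.P) * (1 - 2 * ((1 - D.ev s y (PsiAlphaI01brA D.P)) * (1 - D.ev s y (PsiAlphaI01brB D.P))))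

/-- Cell 37: `Bound[Psi,alphaII,0−1,AroundZero,s] = main[s] + coef[s] · (1 − (1 − brA[s])(1 − brB[s]))`. [cite: FitznerVanDerHofstad2017, notebook Percolation.nb cell 37 (transcript l.1035–1055)] -/
def psiAlphaII01 (s : Pt) (y : State) : ℝ :=
  D.ev s y (PsiAlphaII01main D.P)
    + D.ev s y (PsiAlphaII01coef D.P) * (1 - (1 - D.ev s y (PsiAlphaII01brA D.P)) * (1 - D.ev s y (PsiAlphaII01brB D.P)))

/-- Cell 44: `mumin[s] = z[i] (1 − Max[Bound[G,{1},3,s], Bound[G,{1},3,i]])`. [cite: FitznerVanDerHofstad2017, notebook Percolation.nb cell 44 (transcript l.1214–1216)] -/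
def muMin (s : Pt) (y : State) : ℝ := D.zIr * (1 - max (D.g13 s y) (D.g13 .i y))

/-! ## Cell 44: the App. D input record, and the frame -/

/-- Cell 44 (l.1214–1237): the sixty App. D inputs at point `s` and state `y`, field ↦ `Bound` key as documented on
`BetaMap.Inputs`, in the tail-free variant `T″₀` (`EvenTail ↦ Bound[·,2,·]`, `OddTail ↦ Bound[·,3,·]`); `mu[s] = m`,
`mub[s] = z[s]`. [cite: FitznerVanDerHofstad2017, notebook Percolation.nb cell 44 (transcript l.1214–1237)] -/
def inp (y : State) (s : Pt) : Inputs where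
  mu := y.m
  muMin := D.muMin s y
  mubOverMu := D.ev s y mubOverMu
  mub := D.ev s y z
  xiAlphaOneMinusZeroAtZero := 0
  xiAlphaZeroMinusOneAtZero := 0
  xiAlphaOneMinusZeroAtEi := D.ev s y (XiAlpha10 D.P)
  xiAlphaZeroMinusOneAtEi := D.ev s y (XiAlpha01 D.P)
  xiIotaAlphaIAtEi := D.ev s y (XiIotaAlphaI0 D.P)
  xiIotaAlphaIIAtZero := D.ev s y XiIotaAlphaII0
  xiIotaAlphaISumAroundEi := D.ev s y (XiIotaAlphaISum D.P)
  xiIotaAlphaIISumAroundZero := D.ev s y (XiIotaAlphaIISum D.P)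
  psiAlphaIOneMinusZeroAroundEi := D.ev s y (PsiAlphaI10 D.P)
  psiAlphaIIZeroMinusOneAroundZero := D.psiAlphaII01 s y
  psiAlphaIZeroMinusOneAroundEi := D.psiAlphaI01 s y
  psiAlphaIIOneMinusZeroAroundZero := D.ev s y (PsiAlphaII10 D.P)
  piAlpha := D.ev s y (PiAlpha0 D.P)
  piAlphaLower := D.piAlphaLower0 s y
  piOneLower := D.pi1Lower s y
  psiZeroLower := D.psiLower0 s y
  xiAbs := D.ev s y (XiAbs D.P)
  xiOdd := D.ev s y (XiOdd D.P)
  xiEven := D.ev s y (XiEven D.P)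
  xiEvenTail := D.ev s y (Xi2 D.P)
  xiOddTail := D.ev s y (Xi3 D.P)
  xiR0 := D.ev s y (XiR0 D.P)
  xiR1 := D.ev s y (XiR1 D.P)
  xiR0Delta := D.ev s y (XiR0D D.P)
  xiR1Delta := D.ev s y (XiR1D D.P)
  xiDeltaAbs := D.ev s y (XiAbsD D.P)
  xiOddDelta := D.ev s y (XiOddD D.P)
  xiEvenDelta := D.ev s y (XiEvenD D.P)
  xiOddTailDelta := D.ev s y (Xi3D D.P)
  xiEvenTailDelta := D.ev s y (Xi2D D.P)
  psiRI0 := D.ev s y (PsiRI0 D.P)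
  psiRI1 := D.ev s y (PsiRI1 D.P)
  psiRII0 := D.ev s y (PsiRII0 D.P)
  psiRII1 := D.ev s y (PsiRII1 D.P)
  psiRI0Delta := D.ev s y (PsiRI0D D.P)
  psiRI1Delta := D.ev s y (PsiRI1D D.P)
  psiRII0Delta := D.ev s y (PsiRII0D D.P)
  psiRII1Delta := D.ev s y (PsiRII1D D.P)
  piR0 := D.ev s y (PiR0 D.P)
  piR0DeltaEiEk := D.ev s y (PiR0D D.P)
  xiIotaAbs := D.ev s y (XiIotaAbs D.P)
  xiIotaOdd := D.ev s y (XiIotaOdd D.P)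
  xiIotaEven := D.ev s y (XiIotaEven D.P)
  xiIotaEvenTail := D.ev s y (XiIota2 D.P)
  xiIotaRI0 := D.ev s y (XiIotaRI0 D.P)
  xiIotaRII0 := D.ev s y (XiIotaRII0 D.P)
  xiIotaDeltaEi := D.ev s y (XiIotaAbsDei D.P)
  xiIotaOddDeltaEi := D.ev s y (XiIotaOddDei D.P)
  xiIotaEvenDeltaEi := D.ev s y (XiIotaEvenDei D.P)
  xiIotaEvenTailDeltaEi := D.ev s y (XiIota2Dei D.P)
  xiIotaDeltaZero := D.ev s y (XiIotaAbsD0 D.P)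
  xiIotaOddDeltaZero := D.ev s y (XiIotaOddD0 D.P)
  xiIotaEvenDeltaZero := D.ev s y (XiIotaEvenD0 D.P)
  xiIotaEvenTailDeltaZero := D.ev s y (XiIota2D0 D.P)
  xiIotaRI0DeltaEi := D.ev s y (XiIotaRI0Dei D.P)
  xiIotaRII0DeltaZero := D.ev s y (XiIotaRII0D0 D.P)

/-- STAGE 1 of the typed frame: the input records at both points and `Bound[G,{1},1,o]`, `Bound[G,{2},2,o]`,
`Bound[G,{0,1},2,o]` (cells 5, 6, 8; used by cells 51–54). [cite: FitznerVanDerHofstad2017, notebook Percolation.nb cells 3–44] -/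
def stage1 (y : State) : Stage1 where
  inp := D.inp y
  G11 := D.ev .o y (G1 D.P 1)
  G22 := D.ev .o y (G2 D.P 2)
  G012 := D.ev .o y (G01 D.P 2)

/-- THE TYPED FRAME: `NoGoFrame.Frame` with stage 1 and its validity region given by the cells of `Stage1Cells.lean`.
[cite: FitznerVanDerHofstad2017, notebook Percolation.nb cells 2–54] -/
def frame : Frame ν where
  d := D.dR
  τ := D.τ
  hasT203 := D.hasT203
  codedD20 := D.codedD20
  codedD31 := D.codedD31
  codedD33 := D.codedD33
  printedD36 := D.printedD36
  n0 := D.n0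
  n1 := D.n1
  n2 := D.n2
  n3 := D.n3
  n01 := D.n01
  n11 := D.n11
  n001 := D.n001
  S := D.stage1
  U := D.U

/-- The frame's initial cells are `D.initCell`. [folklore] -/
theorem frame_initCell : D.frame.initCell = D.initCell := rfl

/-- Cell 44: `mu[s] = m` (the field `Frame.Hyp.mu_eq`). [folklore] -/
theorem mu_eq (y : State) (s : Pt) : ((D.frame.S y).inp s).mu = y.m := rfl

end Data

/-! ## Proofs: the stage-1 monotonicity inputs of the no-go theorem as theorems -/

/-- `BoundFThreeInital ≥ 0` for `d ≥ 1`, `rho ≥ 0`, tables `≥ 0`. [folklore] -/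
theorem boundFThreeInitial_nonneg {ν : Type*} {τ : Tables ν} (hτ : τ.Nonneg) {d : ℝ} (hd : 1 ≤ d) (n l : ℕ)
    {rho : ℝ} (h0 : 0 ≤ rho) (v₀ : ν) (vs : List ν) : 0 ≤ boundFThreeInitial τ d n l rho v₀ vs := by
  unfold boundFThreeInitial
  have hq : 0 ≤ ((2*d-2)/(2*d-1)) ^ (n+1) := pow_nonneg (div_nonneg (by linarith) (by linarith)) _
  have base : ∀ v, 0 ≤ rho * ((2*d-2)/(2*d-1)) ^ (n+1) * τ.IM n l v :=
    fun v => mul_nonneg (mul_nonneg h0 hq) (hτ.IM n l v)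
  induction vs with
  | nil => simpa using base v₀
  | cons v vs ih =>
    simp only [List.foldr_cons]
    exact le_max_of_le_right ih

/-- `BoundFThreeInital` (printed exponent) `≥ 0` for `d ≥ 1`, `rho ≥ 0`, tables `≥ 0`. [folklore] -/
theorem boundFThreeInitialPrinted_nonneg {ν : Type*} {τ : Tables ν} (hτ : τ.Nonneg) {d : ℝ} (hd : 1 ≤ d)
    (n l : ℕ) {rho : ℝ} (h0 : 0 ≤ rho) (v₀ : ν) (vs : List ν) :
    0 ≤ boundFThreeInitialPrinted τ d n l rho v₀ vs := by
  unfold boundFThreeInitialPrinted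
  have hq : 0 ≤ (2*d-2)/(2*d-1) := div_nonneg (by linarith) (by linarith)
  have base : ∀ v, 0 ≤ rho * ((2*d-2)/(2*d-1)) * τ.IM n l v :=
    fun v => mul_nonneg (mul_nonneg h0 hq) (hτ.IM n l v)
  induction vs with
  | nil => simpa using base v₀
  | cons v vs ih =>
    simp only [List.foldr_cons]
    exact le_max_of_le_right ih

/-- `(1 − a')(1 − b') ≤ (1 − a)(1 − b)` for `a ≤ a' ≤ 1`, `b ≤ b' ≤ 1`: the product brackets of cells 36–37 are
antitone in their (increasing) arguments while these stay `≤ 1`. [folklore] -/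
theorem prod_anti {a a' b b' : ℝ} (ha : a ≤ a') (hb : b ≤ b') (ha1 : a' ≤ 1) (hb1 : b' ≤ 1) :
    (1 - a') * (1 - b') ≤ (1 - a) * (1 - b) :=
  mul_le_mul (by linarith) (by linarith) (by linarith) (by linarith)

/-- `0 ≤ (1 − a)(1 − b) ≤ 1` for `0 ≤ a, b ≤ 1`. [folklore] -/
theorem prod_mem {a b : ℝ} (ha0 : 0 ≤ a) (ha1 : a ≤ 1) (hb0 : 0 ≤ b) (hb1 : b ≤ 1) :
    0 ≤ (1 - a) * (1 - b) ∧ (1 - a) * (1 - b) ≤ 1 :=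
  ⟨mul_nonneg (by linarith) (by linarith), mul_le_one₀ (by linarith) (by linarith) (by linarith)⟩

/-- the atoms other than the weighted constants `cw j` (those on which the two points are comparable) [folklore] -/
def NotCw : Atom → Prop
  | .cw _ => False
  | _ => True

/-- the atoms other than `VarGamma2[o]` (those whose value at the point `i` does not depend on the state)
[folklore] -/
def NotVo : Atom → Prop
  | .Vo => False
  | _ => True

namespace Data

variable {ν : Type*} (D : Data ν)

/-- STANDING HYPOTHESES of the typed frame above a floor `y₀`: `d ≥ 2`, all tables `≥ 0` (with the three walk-count
differences of cells 7–8 `≥ 0`), and the floor has `Γ₁, Γ₂ ≥ 1`, `c_j ≥ 0`. [folklore] -/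
structure Std (y₀ : State) : Prop where
  two_le_d : 2 ≤ D.P.d
  τ_nonneg : D.τ.Nonneg
  tabs : D.tabs.WF D.P.d
  one_le_Gamma1 : 1 ≤ y₀.Gamma1
  one_le_Gamma2 : 1 ≤ y₀.Gamma2
  c_nonneg : ∀ j, 0 ≤ y₀.c j

variable {D} {y₀ x y : State}

/-! ### Elementary consequences of the standing hypotheses -/

section Elem
variable (H : D.Std y₀)
include H

/-- `2 ≤ d` as reals. [folklore] -/
theorem Std.two_le_dR : (2 : ℝ) ≤ D.dR := by
  have h := H.two_le_d; unfold dR; exact_mod_cast h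

/-- `0 < 2d − 1`. [folklore] -/
theorem Std.den_pos : 0 < 2 * D.dR - 1 := by linarith [H.two_le_dR]

/-- `0 ≤ z_I = 1/(2d−1)`. [folklore] -/
theorem Std.zIr_nonneg : 0 ≤ D.zIr := le_of_lt (one_div_pos.2 H.den_pos)

/-- `z_I ≤ 1`. [folklore] -/
theorem Std.zIr_le_one : D.zIr ≤ 1 := by
  unfold zIr; rw [div_le_one H.den_pos]; linarith [H.two_le_dR]

/-- `z_I < 1`. [folklore] -/
theorem Std.zIr_lt_one : D.zIr < 1 := by
  unfold zIr; rw [div_lt_one H.den_pos]; linarith [H.two_le_dR]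

/-- `0 ≤ 1 − z_I^k`. [folklore] -/
theorem Std.one_sub_zIr_pow_nonneg (k : ℕ) : 0 ≤ 1 - D.zIr ^ k :=
  sub_nonneg.2 (pow_le_one₀ H.zIr_nonneg H.zIr_le_one)

/-- `((2d − 1 : ℕ) : ℝ) = 2d − 1`. [folklore] -/
theorem Std.cast_two_d_sub_one : ((2 * D.P.d - 1 : ℕ) : ℝ) = 2 * D.dR - 1 := by
  have h := H.two_le_d
  rw [Nat.cast_sub (by omega)]; push_cast; unfold dR; ring

/-- `K₂ ≥ 0`. [folklore] -/
theorem Std.K2_nonneg : 0 ≤ D.K2 := by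
  have h2 := H.two_le_dR; have hz := H.zIr_nonneg
  have h3 := H.one_sub_zIr_pow_nonneg 3; have h5 := H.one_sub_zIr_pow_nonneg 5
  unfold K2
  apply_rules [mul_nonneg, pow_nonneg] <;> linarith

/-- `K₃ ≥ 0`. [folklore] -/
theorem Std.K3_nonneg : 0 ≤ D.K3 := by
  have h2 := H.two_le_dR; have hz := H.zIr_nonneg; have hz1 := H.zIr_le_one
  have h3 := H.one_sub_zIr_pow_nonneg 3; have h5 := H.one_sub_zIr_pow_nonneg 5
  unfold K3
  apply_rules [mul_nonneg, pow_nonneg] <;> linarith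

/-- `K₄ ≥ 0`. [folklore] -/
theorem Std.K4_nonneg : 0 ≤ D.K4 := by
  have h2 := H.two_le_dR; have hz := H.zIr_nonneg; have h3 := H.one_sub_zIr_pow_nonneg 3
  unfold K4
  apply_rules [mul_nonneg, pow_nonneg] <;> linarith

/-- `K₅ ≥ 0`. [folklore] -/
theorem Std.K5_nonneg : 0 ≤ D.K5 := by
  have h2 := H.two_le_dR; have hz := H.zIr_nonneg; have h3 := H.one_sub_zIr_pow_nonneg 3
  unfold K5
  apply_rules [mul_nonneg, pow_nonneg] <;> linarith

/-- `Γ₁ ≥ 1` above the floor. [folklore] -/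
theorem Std.one_le_Gamma1_of (hy : y₀ ≤ y) : 1 ≤ y.Gamma1 := H.one_le_Gamma1.trans hy.1
/-- `Γ₂ ≥ 1` above the floor. [folklore] -/
theorem Std.one_le_Gamma2_of (hy : y₀ ≤ y) : 1 ≤ y.Gamma2 := H.one_le_Gamma2.trans hy.2.2.1
/-- `c_j ≥ 0` above the floor. [folklore] -/
theorem Std.c_nonneg_of (hy : y₀ ≤ y) (j : Fin 6) : 0 ≤ y.c j := (H.c_nonneg j).trans (hy.2.2.2 j)

/-- the initial-point cells are `≥ 0`. [folklore] -/
theorem Std.initAt_nonneg (n l : ℕ) (v₀ : ν) (vs : List ν) : 0 ≤ D.initAt n l v₀ vs := by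
  have hd : (1 : ℝ) ≤ D.dR := by linarith [H.two_le_dR]
  unfold initAt
  split
  · exact boundFThreeInitialPrinted_nonneg H.τ_nonneg hd n l zero_le_one v₀ vs
  · exact boundFThreeInitial_nonneg H.τ_nonneg hd n l zero_le_one v₀ vs

/-- `boundF3[j,i] ≥ 0`. [folklore] -/
theorem Std.initCell_nonneg (j : Fin 6) : 0 ≤ D.initCell j := by
  have h := H.initAt_nonneg
  fin_cases j <;> (simp [initCell]; exact h _ _ _ _)

/-! ### The basic valuation: signs, monotonicity in the state, comparison of the two points -/

/-- `z[s] ≥ 0`. [folklore] -/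
theorem Std.zAt_nonneg (hy : y₀ ≤ y) : ∀ s, 0 ≤ D.zAt s y
  | .i => le_of_lt (one_div_pos.2 H.den_pos)
  | .o => div_nonneg (by linarith [H.one_le_Gamma1_of hy]) H.den_pos.le

/-- `VarGamma2[s] ≥ 0`. [folklore] -/
theorem Std.VAt_nonneg (hy : y₀ ≤ y) : ∀ s, 0 ≤ D.VAt s y
  | .i => div_nonneg (by linarith [H.two_le_dR]) H.den_pos.le
  | .o => mul_nonneg (by linarith [H.one_le_Gamma2_of hy]) (div_nonneg (by linarith [H.two_le_dR]) H.den_pos.le)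

/-- the weighted constants are `≥ 0`. [folklore] -/
theorem Std.cAt_nonneg (hy : y₀ ≤ y) : ∀ s j, 0 ≤ D.cAt s y j
  | .i, j => H.initCell_nonneg j
  | .o, j => H.c_nonneg_of hy j

/-- the basic valuation is `≥ 0` above the floor. [folklore] -/
theorem Std.val0_nonneg (hy : y₀ ≤ y) (s : Pt) : ∀ a, 0 ≤ D.val0 s y a
  | .z => H.zAt_nonneg hy s
  | .V => H.VAt_nonneg hy s
  | .cw j => H.cAt_nonneg hy s j
  | .Vo => H.VAt_nonneg hy .o
  | .G13at _ => le_rfl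
  | .mubOverMu => le_rfl
  | .mubOverMuI => le_rfl
  | .hdInv => le_rfl

/-- the basic valuation is monotone in the state. [folklore] -/
theorem Std.val0_mono (hxy : x ≤ y) : ∀ s a, D.val0 s x a ≤ D.val0 s y a
  | .i, .z => le_rfl
  | .o, .z => div_le_div_of_nonneg_right hxy.1 H.den_pos.le
  | .i, .V => le_rfl
  | .o, .V => mul_le_mul_of_nonneg_right hxy.2.2.1 (div_nonneg (by linarith [H.two_le_dR]) H.den_pos.le)
  | .i, .cw _ => le_rfl
  | .o, .cw j => hxy.2.2.2 j
  | _, .Vo => mul_le_mul_of_nonneg_right hxy.2.2.1 (div_nonneg (by linarith [H.two_le_dR]) H.den_pos.le)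
  | _, .G13at _ => le_rfl
  | _, .mubOverMu => le_rfl
  | _, .mubOverMuI => le_rfl
  | _, .hdInv => le_rfl

omit H in
/-- at the initial point only the atom `VarGamma2[o]` (cell 9) depends on the state. [folklore] -/
theorem val0_i_congr (D : Data ν) (x y : State) : ∀ a, NotVo a → D.val0 .i x a = D.val0 .i y a := by
  intro a h; cases a <;> first | rfl | exact h.elim

/-- at comparable atoms the point `i` lies below the point `o` (`z[i] ≤ z[o]`, `VarGamma2[i] ≤ VarGamma2[o]` as
`Γ₁, Γ₂ ≥ 1`). [folklore] -/
theorem Std.val0_i_le_o (hy : y₀ ≤ y) : ∀ a, NotCw a → D.val0 .i y a ≤ D.val0 .o y a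
  | .z, _ => div_le_div_of_nonneg_right (H.one_le_Gamma1_of hy) H.den_pos.le
  | .V, _ => le_mul_of_one_le_left (div_nonneg (by linarith [H.two_le_dR]) H.den_pos.le) (H.one_le_Gamma2_of hy)
  | .cw _, h => h.elim
  | .Vo, _ => le_rfl
  | .G13at _, _ => le_rfl
  | .mubOverMu, _ => le_rfl
  | .mubOverMuI, _ => le_rfl
  | .hdInv, _ => le_rfl

/-- every cell is `≥ 0` under the basic valuation. [folklore] -/
theorem Std.ev0_nonneg (hy : y₀ ≤ y) (s : Pt) (e : T) : 0 ≤ D.ev0 s y e :=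
  eval_nonneg (H.val0_nonneg hy s) H.tabs.val_nonneg e

/-- every cell is monotone in the state under the basic valuation. [folklore] -/
theorem Std.ev0_mono (hx : y₀ ≤ x) (hxy : x ≤ y) (s : Pt) (e : T) : D.ev0 s x e ≤ D.ev0 s y e :=
  eval_mono (H.val0_nonneg hx s) (H.val0_mono hxy s) H.tabs.val_nonneg e

/-- `Bound[G,{1},3,s] ≥ 0`. [folklore] -/
theorem Std.g13_nonneg (hy : y₀ ≤ y) (s : Pt) : 0 ≤ D.g13 s y := H.ev0_nonneg hy s _
/-- `Bound[G,{1},3,s]` is monotone in the state. [folklore] -/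
theorem Std.g13_mono (hx : y₀ ≤ x) (hxy : x ≤ y) (s : Pt) : D.g13 s x ≤ D.g13 s y := H.ev0_mono hx hxy s _
/-- `Bound[OpenBubble,1,s] ≥ 0`. [folklore] -/
theorem Std.ob1_nonneg (hy : y₀ ≤ y) (s : Pt) : 0 ≤ D.ob1 s y := H.ev0_nonneg hy s _
/-- `Bound[OpenBubble,1,s]` is monotone in the state. [folklore] -/
theorem Std.ob1_mono (hx : y₀ ≤ x) (hxy : x ≤ y) (s : Pt) : D.ob1 s x ≤ D.ob1 s y := H.ev0_mono hx hxy s _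

omit H in
/-- `Bound[G,{1},3,i]` does not depend on the state. [folklore] -/
theorem g13_i_const (D : Data ν) (x y : State) : D.g13 .i x = D.g13 .i y := by
  refine eval_congr_on (D.val0_i_congr x y) (G13 D.P) ?_
  simp [OnlyAtoms, G1, w, z, Vg, NotVo]

/-- `Bound[G,{1},3,i] ≤ Bound[G,{1},3,o]`. [folklore] -/
theorem Std.g13_i_le_o (hy : y₀ ≤ y) : D.g13 .i y ≤ D.g13 .o y := by
  refine eval_mono_on (H.val0_nonneg hy .i) (H.val0_nonneg hy .o) (H.val0_i_le_o hy) H.tabs.val_nonneg (G13 D.P) ?_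
  simp [OnlyAtoms, G1, w, z, Vg, NotCw]

/-- `Bound[G,{1},3,i] ≤ Bound[G,{1},3,s]`. [folklore] -/
theorem Std.g13_i_le (hy : y₀ ≤ y) : ∀ s, D.g13 .i y ≤ D.g13 s y
  | .i => le_rfl
  | .o => H.g13_i_le_o hy

end Elem

/-! ### The full valuation on the validity region -/

/-- value of the atom `Bound[G,{1},3,t]`. [folklore] -/
@[simp] theorem val_G13at (s t : Pt) (y : State) : D.val s y (.G13at t) = D.g13 t y := rfl
/-- value of the atom `mubOverMu[s]`. [folklore] -/
@[simp] theorem val_mubOverMu (s : Pt) (y : State) : D.val s y .mubOverMu = 1 / (1 - D.g13 s y) := rfl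
/-- value of the atom `mubOverMu[i]`. [folklore] -/
@[simp] theorem val_mubOverMuI (s : Pt) (y : State) : D.val s y .mubOverMuI = 1 / (1 - D.g13 .i y) := rfl
/-- value of the atom `1/(1 − Bound[OpenBubble,1,s])`. [folklore] -/
@[simp] theorem val_hdInv (s : Pt) (y : State) : D.val s y .hdInv = 1 / (1 - D.ob1 s y) := rfl
/-- value of the atom `z[s]`. [folklore] -/
@[simp] theorem val_z (s : Pt) (y : State) : D.val s y .z = D.zAt s y := rfl
/-- value of the atom `VarGamma2[s]`. [folklore] -/
@[simp] theorem val_V (s : Pt) (y : State) : D.val s y .V = D.VAt s y := rfl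
/-- value of the atom the weighted constant `j`. [folklore] -/
@[simp] theorem val_cw (s : Pt) (y : State) (j : Fin 6) : D.val s y (.cw j) = D.cAt s y j := rfl
/-- value of the atom `VarGamma2[o]`. [folklore] -/
@[simp] theorem val_Vo (s : Pt) (y : State) : D.val s y .Vo = D.VAt .o y := rfl

/-- `1/(1 − g)` is `≥ 0` for `g < 1`. [folklore] -/
theorem inv_one_sub_nonneg {g : ℝ} (h : g < 1) : 0 ≤ 1 / (1 - g) := le_of_lt (one_div_pos.2 (by linarith))

/-- `1/(1 − g)` is monotone in `g < 1`. [folklore] -/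
theorem inv_one_sub_mono {g g' : ℝ} (hle : g ≤ g') (h : g' < 1) : 1 / (1 - g) ≤ 1 / (1 - g') :=
  one_div_le_one_div_of_le (by linarith) (by linarith)

section Val
variable (H : D.Std y₀)
include H

/-- the full valuation is `≥ 0` above the floor while the two geometric ratios are `< 1`. [folklore] -/
theorem Std.val_nonneg (hy : y₀ ≤ y) (hg : ∀ t, D.g13 t y < 1) (s : Pt) (hob : D.ob1 s y < 1) :
    ∀ a, 0 ≤ D.val s y a
  | .G13at t => H.g13_nonneg hy t
  | .mubOverMu => inv_one_sub_nonneg (hg s)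
  | .mubOverMuI => inv_one_sub_nonneg (hg .i)
  | .hdInv => inv_one_sub_nonneg hob
  | .z => H.zAt_nonneg hy s
  | .V => H.VAt_nonneg hy s
  | .cw j => H.cAt_nonneg hy s j
  | .Vo => H.VAt_nonneg hy .o

/-- the full valuation is monotone in the state below a point of the validity region. [folklore] -/
theorem Std.val_mono (hx : y₀ ≤ x) (hxy : x ≤ y) (hg : ∀ t, D.g13 t y < 1) (s : Pt) (hob : D.ob1 s y < 1) :
    ∀ a, D.val s x a ≤ D.val s y a
  | .G13at t => H.g13_mono hx hxy t
  | .mubOverMu => inv_one_sub_mono (H.g13_mono hx hxy s) (hg s)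
  | .mubOverMuI => inv_one_sub_mono (H.g13_mono hx hxy .i) (hg .i)
  | .hdInv => inv_one_sub_mono (H.ob1_mono hx hxy s) hob
  | .z => H.val0_mono hxy s .z
  | .V => H.val0_mono hxy s .V
  | .cw j => H.val0_mono hxy s (.cw j)
  | .Vo => H.val0_mono hxy s .Vo

/-- On the validity region every cell is `≥ 0`. [folklore] -/
theorem Std.ev_nonneg (hy : y₀ ≤ y) (hU : D.U y) (s : Pt) (e : T) : 0 ≤ D.ev s y e :=
  eval_nonneg (H.val_nonneg hy (fun t => (hU t).g13) s (hU s).ob1) H.tabs.val_nonneg e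

/-- Below a point of the validity region every cell is monotone in the state (cells M1 of HOME/MARGINS.md §5, now a
theorem). [folklore] -/
theorem Std.ev_mono (hx : y₀ ≤ x) (hxy : x ≤ y) (hU : D.U y) (s : Pt) (e : T) : D.ev s x e ≤ D.ev s y e := by
  have hg : ∀ t, D.g13 t y < 1 := fun t => (hU t).g13
  have hgx : ∀ t, D.g13 t x < 1 := fun t => (H.g13_mono hx hxy t).trans_lt (hg t)
  have hobx : D.ob1 s x < 1 := (H.ob1_mono hx hxy s).trans_lt (hU s).ob1
  exact eval_mono (H.val_nonneg hx hgx s hobx) (H.val_mono hx hxy hg s (hU s).ob1) H.tabs.val_nonneg e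

/-! ### The bracket arguments: dominations and the range `[0,1]` on the validity region -/

/-- `Br₄a ≤ Br₃a`. [folklore] -/
theorem Std.br4a_le_br3a (hy : y₀ ≤ y) (hU : D.U y) (s : Pt) :
    D.ev s y (pi1Br4a D.P) ≤ D.ev s y (pi1Br3a D.P) := by
  have h := H.ev_nonneg hy hU s (z ^ 2 + C 2 * z ^ 3 + C 2 * theta4 D.P + vartheta D.P)
  simp only [ev, pi1Br3a, eval_add] at h ⊢; linarith

/-- `Br₄b ≤ Br₃b`. [folklore] -/
theorem Std.br4b_le_br3b (hy : y₀ ≤ y) (hU : D.U y) (s : Pt) :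
    D.ev s y (pi1Br4b D.P) ≤ D.ev s y (pi1Br3b D.P) := by
  have h := H.ev_nonneg hy hU s (vartheta D.P)
  simp only [ev, pi1Br3b, eval_add] at h ⊢; linarith

/-- `Br₃b ≤ Br₅b`. [folklore] -/
theorem Std.br3b_le_br5b (hy : y₀ ≤ y) (hU : D.U y) (s : Pt) :
    D.ev s y (pi1Br3b D.P) ≤ D.ev s y (pi1Br5b D.P) := by
  have h := H.ev_nonneg hy hU s (G13 D.P)
  simp only [ev, pi1Br5b, eval_add] at h ⊢; linarith

/-- `2G₁₃ + Gik₂ ≤ Br₅b = 2G₁₃ + θ₂ + ϑ`. [folklore] -/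
theorem Std.brIA_le_br5b (hy : y₀ ≤ y) (hU : D.U y) (s : Pt) :
    D.ev s y (PsiAlphaI01brA D.P) ≤ D.ev s y (pi1Br5b D.P) := by
  have h := H.ev_nonneg hy hU s (vartheta D.P)
  have hm := le_max_left (D.ev s y (Gik2 D.P)) (D.ev s y (Gtwoi2 D.P))
  simp only [ev, PsiAlphaI01brA, pi1Br5b, pi1Br3b, pi1Br4b, theta2, eval_add, eval_mul, eval_C, eval_max,
    Nat.cast_ofNat] at h hm ⊢
  linarith

/-- `G₁₃[o] + θ₂ ≤ G₁₃[o] + θ₂ + ϑ`. [folklore] -/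
theorem Std.brIB_le_brIIB (hy : y₀ ≤ y) (hU : D.U y) (s : Pt) :
    D.ev s y (PsiAlphaI01brB D.P) ≤ D.ev s y (PsiAlphaII01brB D.P) := by
  have h := H.ev_nonneg hy hU s (vartheta D.P)
  simp only [ev, PsiAlphaII01brB, eval_add] at h ⊢; linarith

/-- On the validity region all nine bracket arguments lie in `[0,1]`. [folklore] -/
theorem Std.brackets (hy : y₀ ≤ y) (hU : D.U y) (s : Pt) :
    D.ev s y (pi1Br3a D.P) ≤ 1 ∧ D.ev s y (pi1Br3b D.P) ≤ 1 ∧ D.ev s y (pi1Br4a D.P) ≤ 1 ∧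
    D.ev s y (pi1Br4b D.P) ≤ 1 ∧ D.ev s y (pi1Br5a D.P) ≤ 1 ∧ D.ev s y (pi1Br5b D.P) ≤ 1 ∧
    D.ev s y (PsiAlphaI01brA D.P) ≤ 1 ∧ D.ev s y (PsiAlphaI01brB D.P) ≤ 1 ∧
    D.ev s y (PsiAlphaII01brA D.P) ≤ 1 ∧ D.ev s y (PsiAlphaII01brB D.P) ≤ 1 := by
  have U := hU s
  have h1 := H.br4a_le_br3a hy hU s; have h2 := H.br4b_le_br3b hy hU s; have h3 := H.br3b_le_br5b hy hU s
  have h4 := H.brIA_le_br5b hy hU s; have h5 := H.brIB_le_brIIB hy hU s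
  exact ⟨U.br3a, h3.trans U.br5b, h1.trans U.br3a, h2.trans (h3.trans U.br5b), U.br5a, U.br5b, h4.trans U.br5b,
    h5.trans U.brIIB, U.brIIA, U.brIIB⟩

/-! ### `U` is downward closed -/

/-- `U` is downward closed in the cone above the floor (`Frame.Hyp.U_down`). [folklore] -/
theorem Std.U_down (hx : y₀ ≤ x) (hxy : x ≤ y) (hU : D.U y) : D.U x := fun s =>
  { g13 := (H.g13_mono hx hxy s).trans_lt (hU s).g13
    ob1 := (H.ob1_mono hx hxy s).trans_lt (hU s).ob1
    br3a := (H.ev_mono hx hxy hU s _).trans (hU s).br3a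
    br5a := (H.ev_mono hx hxy hU s _).trans (hU s).br5a
    br5b := (H.ev_mono hx hxy hU s _).trans (hU s).br5b
    brIIA := (H.ev_mono hx hxy hU s _).trans (hU s).brIIA
    brIIB := (H.ev_mono hx hxy hU s _).trans (hU s).brIIB }

/-! ### The lower bounds are antitone, `mumin < 1`, the bracketed upper bounds are monotone and `≥ 0` -/

/-- `Bound[Pi,alpha,lower,0,s]` is antitone in the state (M3). [folklore] -/
theorem Std.piAlphaLower0_anti (hx : y₀ ≤ x) (hxy : x ≤ y) (hU : D.U y) (s : Pt) :
    D.piAlphaLower0 s y ≤ D.piAlphaLower0 s x := by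
  unfold piAlphaLower0
  have h1 := H.ev_mono hx hxy hU s (piAlphaLowSub D.P)
  have h2 := mul_le_mul_of_nonneg_left (sub_le_sub_left (H.ev_mono hx hxy hU s (piAlphaLowBr D.P)) 1) H.K2_nonneg
  linarith

/-- `Bound[Psi,lower,0,s]` is antitone in the state (M3). [folklore] -/
theorem Std.psiLower0_anti (hx : y₀ ≤ x) (hxy : x ≤ y) (hU : D.U y) (s : Pt) :
    D.psiLower0 s y ≤ D.psiLower0 s x := by
  unfold psiLower0
  have hd := H.two_le_dR; have hz := H.zIr_nonneg
  have c1 : 0 ≤ (2 * D.dR - 2) ^ 2 * D.zIr ^ 4 := by positivity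
  have c2 : 0 ≤ 2 * D.dR * (2 * D.dR - 2) * D.zIr ^ 4 := by
    apply_rules [mul_nonneg, pow_nonneg] <;> linarith
  have h1 := H.ev_mono hx hxy hU s (piAlphaLowSub D.P)
  have h2 := mul_le_mul_of_nonneg_left (sub_le_sub_left (H.ev_mono hx hxy hU s (psiLowBr1 D.P)) 1) c1
  have h3 := mul_le_mul_of_nonneg_left (H.ev_mono hx hxy hU s (vartheta D.P)) c2
  have h4 := mul_le_mul_of_nonneg_left (sub_le_sub_left (H.ev_mono hx hxy hU s (psiLowBr2 D.P)) 1) H.K3_nonneg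
  linarith

/-- `Bound[Pi,1,Lower,s]` is antitone in the state below a point of the validity region (M3; this is where the
bracket conditions of `U` are used). [folklore] -/
theorem Std.pi1Lower_anti (hx : y₀ ≤ x) (hxy : x ≤ y) (hU : D.U y) (s : Pt) :
    D.pi1Lower s y ≤ D.pi1Lower s x := by
  unfold pi1Lower
  have hd := H.two_le_dR; have hz := H.zIr_nonneg
  have c0 : 0 ≤ (2 * D.dR - 1) * (2 * D.dR - 2) * D.zIr ^ 5 := by
    apply_rules [mul_nonneg, pow_nonneg] <;> linarith
  have c1 : 0 ≤ (2 * D.dR - 2) * D.zIr ^ 5 := mul_nonneg (by linarith) (pow_nonneg hz 5)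
  obtain ⟨b3a, b3b, b4a, b4b, b5a, b5b, -, -, -, -⟩ := H.brackets (hx.trans hxy) hU s
  have M := fun e => H.ev_mono hx hxy hU s e
  have h0 := mul_le_mul_of_nonneg_left (sub_le_sub_left (M (pi1Br0 D.P)) 1) c0
  have h2 := mul_le_mul_of_nonneg_left (M (pi1T2 D.P)) c1
  have h3 := mul_le_mul_of_nonneg_left (prod_anti (M (pi1Br3a D.P)) (M (pi1Br3b D.P)) b3a b3b) H.K4_nonneg
  have h4 := mul_le_mul_of_nonneg_left (prod_anti (M (pi1Br4a D.P)) (M (pi1Br4b D.P)) b4a b4b) H.K4_nonneg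
  have h5 := mul_le_mul_of_nonneg_left (prod_anti (M (pi1Br5a D.P)) (M (pi1Br5b D.P)) b5a b5b) H.K5_nonneg
  linarith

/-- `mumin[s]` is antitone in the state (M3). [folklore] -/
theorem Std.muMin_anti (hx : y₀ ≤ x) (hxy : x ≤ y) (s : Pt) : D.muMin s y ≤ D.muMin s x := by
  unfold muMin
  have h := max_le_max (H.g13_mono hx hxy s) (H.g13_mono hx hxy .i)
  exact mul_le_mul_of_nonneg_left (by linarith) H.zIr_nonneg

/-- `mumin[s] < 1` (it is `z_I (1 − …) ≤ z_I < 1`). [folklore] -/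
theorem Std.muMin_lt_one (hy : y₀ ≤ y) (s : Pt) : D.muMin s y < 1 := by
  unfold muMin
  have h0 : 0 ≤ max (D.g13 s y) (D.g13 .i y) := le_max_of_le_left (H.g13_nonneg hy s)
  have h1 : D.zIr * (1 - max (D.g13 s y) (D.g13 .i y)) ≤ D.zIr * 1 :=
    mul_le_mul_of_nonneg_left (by linarith) H.zIr_nonneg
  linarith [H.zIr_lt_one]

omit H in
/-- the coefficient `(2d−2) mubOverMu[i] z_I⁴` of cell 37 does not depend on the state. [folklore] -/
theorem coef_const (D : Data ν) (s : Pt) (x y : State) :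
    D.ev s x (PsiAlphaI01coef D.P) = D.ev s y (PsiAlphaI01coef D.P) := by
  simp only [ev, PsiAlphaI01coef, zI, eval_mul, eval_C, eval_hpow, eval_atom, eval_divN, val_mubOverMuI,
    g13_i_const D x y]

/-- `Bound[Psi,alphaI,0−1,AroundEi,s]` is monotone in the state below a point of the validity region (M1 for a
bracketed cell). [folklore] -/
theorem Std.psiAlphaI01_mono (hx : y₀ ≤ x) (hxy : x ≤ y) (hU : D.U y) (s : Pt) :
    D.psiAlphaI01 s x ≤ D.psiAlphaI01 s y := by
  unfold psiAlphaI01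
  obtain ⟨-, -, -, -, -, -, bA, bB, -, -⟩ := H.brackets (hx.trans hxy) hU s
  have M := fun e => H.ev_mono hx hxy hU s e
  have hc := H.ev_nonneg (hx.trans hxy) hU s (PsiAlphaI01coef D.P)
  have hp := prod_anti (M (PsiAlphaI01brA D.P)) (M (PsiAlphaI01brB D.P)) bA bB
  rw [D.coef_const s x y]
  have h2 := mul_le_mul_of_nonneg_left (show
      1 - 2 * ((1 - D.ev s x (PsiAlphaI01brA D.P)) * (1 - D.ev s x (PsiAlphaI01brB D.P)))
        ≤ 1 - 2 * ((1 - D.ev s y (PsiAlphaI01brA D.P)) * (1 - D.ev s y (PsiAlphaI01brB D.P))) by linarith) hc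
  linarith [M (PsiAlphaI01main D.P)]

/-- `Bound[Psi,alphaII,0−1,AroundZero,s]` is monotone in the state below a point of the validity region. [folklore] -/
theorem Std.psiAlphaII01_mono (hx : y₀ ≤ x) (hxy : x ≤ y) (hU : D.U y) (s : Pt) :
    D.psiAlphaII01 s x ≤ D.psiAlphaII01 s y := by
  unfold psiAlphaII01
  have hUx := H.U_down hx hxy hU
  obtain ⟨-, -, -, -, -, -, -, -, bA, bB⟩ := H.brackets (hx.trans hxy) hU s
  obtain ⟨-, -, -, -, -, -, -, -, bAx, bBx⟩ := H.brackets hx hUx s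
  have M := fun e => H.ev_mono hx hxy hU s e
  have hcy := H.ev_nonneg (hx.trans hxy) hU s (PsiAlphaII01coef D.P)
  have hp := prod_anti (M (PsiAlphaII01brA D.P)) (M (PsiAlphaII01brB D.P)) bA bB
  have hpx := (prod_mem (H.ev_nonneg hx hUx s (PsiAlphaII01brA D.P)) bAx
    (H.ev_nonneg hx hUx s (PsiAlphaII01brB D.P)) bBx).2
  have h2 : D.ev s x (PsiAlphaII01coef D.P) *
      (1 - (1 - D.ev s x (PsiAlphaII01brA D.P)) * (1 - D.ev s x (PsiAlphaII01brB D.P)))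
      ≤ D.ev s y (PsiAlphaII01coef D.P) *
      (1 - (1 - D.ev s y (PsiAlphaII01brA D.P)) * (1 - D.ev s y (PsiAlphaII01brB D.P))) :=
    mul_le_mul (M _) (by nlinarith) (by nlinarith) hcy
  linarith [M (PsiAlphaII01main D.P)]

/-- `Bound[Psi,alphaII,0−1,AroundZero,s] ≥ 0` on the validity region. [folklore] -/
theorem Std.psiAlphaII01_nonneg (hy : y₀ ≤ y) (hU : D.U y) (s : Pt) : 0 ≤ D.psiAlphaII01 s y := by
  unfold psiAlphaII01
  obtain ⟨-, -, -, -, -, -, -, -, bA, bB⟩ := H.brackets hy hU s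
  have hp := (prod_mem (H.ev_nonneg hy hU s (PsiAlphaII01brA D.P)) bA (H.ev_nonneg hy hU s (PsiAlphaII01brB D.P)) bB).2
  have hm := H.ev_nonneg hy hU s (PsiAlphaII01main D.P)
  have hc := H.ev_nonneg hy hU s (PsiAlphaII01coef D.P)
  nlinarith

/-- `z_I ≤ z[s]` (`Γ₁ ≥ 1`). [folklore] -/
theorem Std.zIr_le_zAt (hy : y₀ ≤ y) : ∀ s, D.zIr ≤ D.zAt s y
  | .i => le_rfl
  | .o => div_le_div_of_nonneg_right (H.one_le_Gamma1_of hy) H.den_pos.le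

/-- `mubOverMu[i] ≤ mubOverMu[s]` on the validity region. [folklore] -/
theorem Std.mubI_le (hy : y₀ ≤ y) (hU : D.U y) (s : Pt) : 1 / (1 - D.g13 .i y) ≤ 1 / (1 - D.g13 s y) :=
  inv_one_sub_mono (H.g13_i_le hy s) (hU s).g13

/-- The first part of `Bound[Psi,alphaI,0−1,AroundEi,s]` dominates its bracket coefficient:
`mubOverMu[s] z[s]² (2d−2) z[s]² ≥ (2d−2) mubOverMu[i] z_I⁴`. [folklore] -/
theorem Std.coef_le_main (hy : y₀ ≤ y) (hU : D.U y) (s : Pt) :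
    D.ev s y (PsiAlphaI01coef D.P) ≤ D.ev s y (PsiAlphaI01main D.P) := by
  have hk : 0 ≤ ((2 * D.P.d - 2 : ℕ) : ℝ) := Nat.cast_nonneg _
  have hzI : 0 ≤ D.zIr := H.zIr_nonneg
  have hz := H.zIr_le_zAt hy s
  have hmI : 0 ≤ 1 / (1 - D.g13 .i y) := inv_one_sub_nonneg (hU .i).g13
  have hm := H.mubI_le hy hU s
  have hA := H.ev_nonneg hy hU s (Gik4 D.P)
  have hB := H.ev_nonneg hy hU s (Gtwoi2 D.P)
  have hG := H.ev_nonneg hy hU s (G13 D.P ^ 2)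
  have hk' : 0 ≤ ((4 * (D.P.d - 1) : ℕ) : ℝ) := Nat.cast_nonneg _
  have hk'' : 0 ≤ ((4 * D.P.d - 3 : ℕ) : ℝ) := Nat.cast_nonneg _
  have hzI_eval : D.ev s y (zI D.P) = D.zIr := by
    simp only [ev, zI, eval_divN, eval_C, Nat.cast_one, H.cast_two_d_sub_one]; rfl
  have hms : 0 ≤ 1 / (1 - D.g13 s y) := hmI.trans hm
  have hzs : 0 ≤ D.zAt s y := hzI.trans hz
  have step1 : ((2 * D.P.d - 2 : ℕ) : ℝ) * (1 / (1 - D.g13 .i y)) * D.zIr ^ 4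
      ≤ ((2 * D.P.d - 2 : ℕ) : ℝ) * (1 / (1 - D.g13 s y)) * D.zAt s y ^ 4 :=
    mul_le_mul (mul_le_mul_of_nonneg_left hm hk) (pow_le_pow_left₀ hzI hz 4) (pow_nonneg hzI 4)
      (mul_nonneg hk hms)
  have step2 : ((2 * D.P.d - 2 : ℕ) : ℝ) * (1 / (1 - D.g13 s y)) * D.zAt s y ^ 4
      ≤ D.ev s y (PsiAlphaI01main D.P) := by
    simp only [ev, PsiAlphaI01main, eval_mul, eval_add, eval_C, eval_hpow, z, val_z, eval_atom, mubOverMu,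
      val_mubOverMu] at hA hB hG ⊢
    have hR : 0 ≤ ((4 * (D.P.d - 1) : ℕ) : ℝ) * eval (D.val s y) (D.tabs.val D.P.d) (Gik4 D.P)
        + eval (D.val s y) (D.tabs.val D.P.d) (Gtwoi2 D.P)
        + ((4 * D.P.d - 3 : ℕ) : ℝ) * eval (D.val s y) (D.tabs.val D.P.d) (G13 D.P) ^ 2 :=
      add_nonneg (add_nonneg (mul_nonneg hk' hA) hB) (mul_nonneg hk'' hG)
    have hprod := mul_nonneg (mul_nonneg hms (pow_nonneg hzs 2)) hR
    nlinarith [hprod]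
  have hcoef : D.ev s y (PsiAlphaI01coef D.P) = ((2 * D.P.d - 2 : ℕ) : ℝ) * (1 / (1 - D.g13 .i y)) * D.zIr ^ 4 := by
    rw [← hzI_eval]; simp only [ev, PsiAlphaI01coef, eval_mul, eval_C, eval_hpow, eval_atom, val_mubOverMuI]
  rw [hcoef]; exact step1.trans step2

/-- `Bound[Psi,alphaI,0−1,AroundEi,s] ≥ 0` on the validity region: `main + coef (1 − 2P) ≥ main − coef ≥ 0` for
`P ∈ [0,1]`. [folklore] -/
theorem Std.psiAlphaI01_nonneg (hy : y₀ ≤ y) (hU : D.U y) (s : Pt) : 0 ≤ D.psiAlphaI01 s y := by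
  unfold psiAlphaI01
  obtain ⟨-, -, -, -, -, -, bA, bB, -, -⟩ := H.brackets hy hU s
  have hp := prod_mem (H.ev_nonneg hy hU s (PsiAlphaI01brA D.P)) bA (H.ev_nonneg hy hU s (PsiAlphaI01brB D.P)) bB
  have hc := H.ev_nonneg hy hU s (PsiAlphaI01coef D.P)
  have hmc := H.coef_le_main hy hU s
  nlinarith

/-! ### The four `Frame.Hyp` fields and the assembled hypotheses -/

/-- STAGE 1 IS MONOTONE (`Frame.Hyp.mono`): between comparable states of the cone above the floor whose upper one lies
in `U`, every App. D input moves in the information order `BetaMap.Inputs.Dom` and the three two-point bounds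
increase — the cell signs M1–M6 of HOME/MARGINS.md §5 as a theorem. [folklore] -/
theorem Std.mono (hx : y₀ ≤ x) (hxy : x ≤ y) (hU : D.U y) : (D.stage1 x).Dom (D.stage1 y) := by
  have E := fun s e => H.ev_mono hx hxy hU s e
  refine ⟨fun s => ?_, E .o _, E .o _, E .o _⟩
  constructor
  all_goals first
    | exact E s _
    | exact hxy.2.1
    | exact H.muMin_anti hx hxy s
    | exact H.piAlphaLower0_anti hx hxy hU s
    | exact H.pi1Lower_anti hx hxy hU s
    | exact H.psiLower0_anti hx hxy hU s
    | exact H.psiAlphaI01_mono hx hxy hU s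
    | exact H.psiAlphaII01_mono hx hxy hU s
    | exact le_rfl

/-- STAGE 1 HAS THE STRUCTURAL SIGNS on `U` (`Frame.Hyp.nonneg`). [folklore] -/
theorem Std.nonneg (hy : y₀ ≤ y) (hU : D.U y) : (D.stage1 y).Nonneg := by
  have E := fun s e => H.ev_nonneg hy hU s e
  refine ⟨fun s => ?_, E .o _, E .o _, E .o _⟩
  constructor
  all_goals first
    | exact E s _
    | exact H.muMin_lt_one hy s
    | exact H.psiAlphaI01_nonneg hy hU s
    | exact H.psiAlphaII01_nonneg hy hU s
    | exact le_rfl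

/-- `U` of the typed frame is downward closed (`Frame.Hyp.U_down`). [folklore] -/
theorem Std.frame_U_down (hx : y₀ ≤ x) (hxy : x ≤ y) (hU : D.frame.U y) : D.frame.U x := H.U_down hx hxy hU

/-- THE STAGE-1 HYPOTHESES OF THE NO-GO THEOREM FOR THE TYPED FRAME: under the standing hypotheses every field of
`NoGoFrame.Frame.Hyp y₀` except the three floor sign checks `0 ≤ m(y₀)`, `0 ≤ 1 + β_Π̂(y₀,s)` is a theorem; in
particular the monotonicity inputs (REFEREE R38.3) are no longer a census. [folklore] -/
theorem Std.hyp (hm : 0 ≤ y₀.m) (hPi : ∀ s, 0 ≤ 1 + (D.frame.betaAt y₀ s).βPi) : D.frame.Hyp y₀ where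
  two_le_d := H.two_le_dR
  tables := H.τ_nonneg
  U_down := fun _ _ hx hxy hU => H.U_down hx hxy hU
  mono := fun _ _ hx hxy hU => H.mono hx hxy hU
  nonneg := fun _ hy hU => H.nonneg hy hU
  mu_eq := fun _ _ _ => rfl
  m_floor := hm
  Gamma1_floor := zero_le_one.trans H.one_le_Gamma1
  Gamma2_floor := zero_le_one.trans H.one_le_Gamma2
  onePlusPi_floor := hPi

end Val

end Data

end Stage1Cells
end Literature.Probability.FitznerVanDerHofstad2017
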